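import Mathlib
import HarnessLib
import Summits.PneNP.PneNP.Theses.OneSlice
import Literature.Computability.Complexity.Circuit
import Literature.Computability.Complexity.CircuitComposition
import Literature.Computability.Complexity.CircuitClassesProofs
import Literature.Computability.Complexity.DeMorganSimulation
import Literature.Computability.Complexity.NegationElimination
import Literature.Computability.Complexity.NegationLimitedProofs
import Literature.Computability.Complexity.SliceFunctions
import Literature.Computability.Complexity.SliceFunctionsProofs
import Literature.Computability.Complexity.PseudoComplementCircuit
import Literature.Computability.Complexity.CircuitLowerBoundsProofs
import Literature.Computability.Complexity.Rossman2008CliqueProofs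

/-!
# Route OneSlice, item `SliceMonotonization` (stmt-PneNP-2836): Berkowitz's slice
# monotonization in crude polynomial form

We prove `Summit.PneNP.PneNP.Theses.OneSlice.SliceMonotonization`: there is `c₀` (here
`c₀ = 28`) such that for all `n`, `0 < M < C(n,2)` and every `B₂`-circuit `C` on the `C(n,2)`
edge variables of `K_n` there is a circuit `C'` over the constant-free monotone basis
`{∧₂, ∨₂}` with `|C'| ≤ c₀ (|C| + n^{c₀})` and `C'(x) = C(x)` for every `x` with exactly `M`
ones (Berkowitz 1982; Jukna 2012, Thm. 10.1; Valiant 1986; Wegener 1985).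

Proof (all ingredients are proved tree theorems; everything is assembled in the `CktSize`
calculus of `CircuitComposition.lean`, on the variable set `Fin N`, `N = C(n,2)`, and transported
along `Fintype.equivFin`):

1. `B₂ → {∧₂, ∨₂, ¬}` with `≤ 12 s + 3` gates (`CktSize.deMorgan_of_B2`);
2. De Morgan doubling (`doubling_cktSize`, Jukna 2012, proof of Thm. 10.18): a monotone program
   `F` on the `2N` literals `(x, ¬x)` with `≤ 2 (12 s + 3)` gates and `F(x, ¬x) = C(x)`;
3. the `N` pseudo-complements `Th_M(x - xᵢ)` by one program over `{∧₂, ∨₂, 0, 1}`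
   (`PseudoCompl.cktSize_pseudoComplements`, Wegener 1987, Thm. 6.13.3), of size
   `1 + size2 m m ≤ 22 N³` (`m = ⌊log₂ N⌋ + 1`); feeding them into the negative literals of `F`
   gives `G(x) = F(x, Th_M(x - x₁), …)`, which equals `C(x)` ON the slice `|x| = M` by
   Berkowitz's identity (10.1) `Th_M(x - xᵢ) = ¬xᵢ` (`pseudoComplement_eq_not`) — no sandwich
   argument is needed since only the slice matters;
4. constant elimination (`GateList.const_or_exists_monotone_circuit`): either `G` is computed
   over `{∧₂, ∨₂}` with no more gates, or `G` is a constant `b`; in the latter case the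
   conjunction (`b = 0`, false on the slice as `M < N`) or disjunction (`b = 1`, true on the
   slice as `0 < M`) of all `N` variables (`cktSize_all` / `cktSize_any`, `≤ N` gates) agrees
   with `C` on the slice.

Total: `≤ 24 s + 6 + 22 N³ ≤ 28 (s + n^28)` gates using `N = C(n,2) ≤ n²`.

## References
* S. J. Berkowitz, *On some relationships between monotone and non-monotone circuit
  complexity*, Technical Report, University of Toronto (1982) [Berkowitz1982].
* S. Jukna, *Boolean Function Complexity* (2012), §10.1.1, Thm. 10.1 [Jukna2012].
* L. G. Valiant, *Negation is powerless for Boolean slice functions*, SIAM J. Comput. 15 (1986)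
  [Valiant1986]; I. Wegener, *On the complexity of slice functions*, TCS 38 (1985) [Wegener1985].
-/

set_option linter.dupNamespace false -- `Summit.PneNP.PneNP.…`: summit = sub-problem (D-0017)

namespace Summit.PneNP.PneNP.Theorems

open Finset Literature.Computability.Complexity Literature.Computability.Complexity.GateList

/-- Size bookkeeping for the pseudo-complement program of `PseudoCompl.cktSize_pseudoComplements`:
with `m = ⌊log₂ N⌋ + 1` (so `m ≤ N`, `2^m ≤ 2N`), `1 + size2 m m ≤ 22 N³` for `N ≥ 1`. [folklore] -/
theorem oneSlice_size2_le {N : ℕ} (hN : 1 ≤ N) :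
    1 + PseudoCompl.size2 (Nat.log 2 N + 1) (Nat.log 2 N + 1) ≤ 22 * N ^ 3 := by
  have hm : Nat.log 2 N + 1 ≤ N := Nat.log_lt_self 2 (by omega)
  have hP : 2 ^ (Nat.log 2 N + 1) ≤ 2 * N := by
    rw [pow_succ]
    have := Nat.pow_log_le_self 2 (show N ≠ 0 by omega)
    omega
  unfold PseudoCompl.size2
  generalize 2 ^ (Nat.log 2 N + 1) = P at *
  generalize Nat.log 2 N + 1 = m at *
  have h1 : m * (m * P) ≤ N * (N * (2 * N)) :=
    Nat.mul_le_mul hm (Nat.mul_le_mul hm hP)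
  have h2 : m * (1 + 4 * ((m + 1) * P)) ≤ N * (1 + 4 * ((N + 1) * (2 * N))) :=
    Nat.mul_le_mul hm (Nat.add_le_add_left (Nat.mul_le_mul_left 4
      (Nat.mul_le_mul (Nat.add_le_add_right hm 1) hP)) 1)
  have h3 : N ≤ N ^ 3 := by
    calc N = N * 1 * 1 := by ring
      _ ≤ N * N * N := Nat.mul_le_mul (Nat.mul_le_mul le_rfl hN) hN
      _ = N ^ 3 := by ring
  have h4 : N * N ≤ N ^ 3 := by
    calc N * N = N * N * 1 := by ring
      _ ≤ N * N * N := Nat.mul_le_mul le_rfl hN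
      _ = N ^ 3 := by ring
  have h5 : 1 ≤ N ^ 3 := Nat.one_le_pow _ _ hN
  have e1 : N * (N * (2 * N)) = 2 * N ^ 3 := by ring
  have e2 : N * (1 + 4 * ((N + 1) * (2 * N))) = N + 8 * N ^ 3 + 8 * (N * N) := by ring
  rw [e1] at h1
  rw [e2] at h2
  omega

/-- The Hamming weight of an input transported along `e : ι ≃ Fin N` is the number of ones of
the original input. [folklore] -/
theorem oneSlice_hammingWeight_comp {ι : Type*} [Fintype ι] {N : ℕ} (e : ι ≃ Fin N)
    (x : ι → Bool) :
    hammingWeight (fun j => x (e.symm j)) = (univ.filter fun i => x i = true).card := by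
  unfold hammingWeight
  exact Finset.card_equiv e.symm fun j => by simp

/-- **Slice monotonization, core form** on an arbitrary finite variable set `ι` with
`N = card ι`: for `0 < M < N` and every `B₂`-circuit `C` there is a circuit over `{∧₂, ∨₂}` with
at most `24 |C| + 6 + 22 N³` gates agreeing with `C` on all inputs with exactly `M` ones
(Berkowitz 1982; Jukna 2012, Thm. 10.1 — via De Morgan doubling, pseudo-complements and
constant elimination, see the module docstring). [cite: Jukna2012, Thm. 10.1 (PDF p. 300)] -/
theorem oneSlice_sliceMonotonization_core {ι : Type} [Fintype ι] [DecidableEq ι] (M : ℕ)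
    (hM0 : 0 < M) (hMN : M < Fintype.card ι) (C : Circuit ι) (hC : C.IsOver B2) :
    ∃ C' : Circuit ι, C'.IsOver monotoneBasis ∧
      C'.size ≤ 24 * C.size + 6 + 22 * Fintype.card ι ^ 3 ∧
      ∀ x : ι → Bool, (univ.filter fun i => x i = true).card = M → C'.eval x = C.eval x := by
  classical
  set N := Fintype.card ι with hNdef
  have hN0 : 0 < N := by omega
  set e : ι ≃ Fin N := Fintype.equivFin ι with he
  -- two slice facts: some variable is on, some variable is off
  have hon : ∀ x : ι → Bool, (univ.filter fun i => x i = true).card = M → ∃ i, x i = true := by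
    intro x hx
    by_contra h
    have h' : ∀ i, x i = false := fun i => Bool.eq_false_iff.2 fun hi => h ⟨i, hi⟩
    have : (univ.filter fun i => x i = true) = ∅ := by
      ext i
      simp [h' i]
    rw [this, card_empty] at hx
    omega
  have hoff : ∀ x : ι → Bool, (univ.filter fun i => x i = true).card = M → ∃ i, x i = false := by
    intro x hx
    by_contra h
    have h' : ∀ i, x i = true := fun i => by
      by_contra hi
      exact h ⟨i, by simpa using hi⟩
    have : (univ.filter fun i => x i = true) = univ := by
      ext i
      simpa using h' i
    rw [this, card_univ] at hx
    omega
  -- step 1: `B₂ → {∧₂, ∨₂, ¬}`, on the variables `Fin N`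
  have h0 : CktSize B2 (fun (y : Fin N → Bool) (_ : Unit) => C.eval fun i => y (e i)) C.size :=
    (Circuit.cktSize_eval C hC).rewire e
  have h1 : CktSize deMorganBasis (fun (y : Fin N → Bool) (_ : Unit) => C.eval fun i => y (e i))
      (12 * C.size + 3) := h0.deMorgan_of_B2 ⟨0, hN0⟩
  obtain ⟨C₁, hB₁, hs₁, hev₁⟩ := h1.toCircuit
  -- step 2: De Morgan doubling
  obtain ⟨F, hF, hFl⟩ := doubling_cktSize C₁ hB₁
  -- step 3: pseudo-complements into the negative literals
  have hP := PseudoCompl.cktSize_pseudoComplements N M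
  have hG : CktSize monotoneBasis01
      (fun (y : Fin N → Bool) => F (Sum.elim y fun i => pseudoComplement M i y))
      (0 + (1 + PseudoCompl.size2 (Nat.log 2 N + 1) (Nat.log 2 N + 1)) + 2 * C₁.size) :=
    (((CktSize.id monotoneBasis01).pair hP).comp
      (hF.basis_mono monotoneBasis_subset_monotoneBasis01)).congr fun _ _ => rfl
  obtain ⟨gs, out, hl, hR⟩ := hG
  have hslice : ∀ y : Fin N → Bool, hammingWeight y = M →
      wireOf y (vals gs y) (out ()) = C.eval fun i => y (e i) := by
    intro y hy
    rw [hR.eval y ()]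
    have hlits : (Sum.elim y fun i => pseudoComplement M i y) = lits y := by
      funext w
      rcases w with i | i
      · rfl
      · exact pseudoComplement_eq_not i y hy
    show F (Sum.elim y fun i => pseudoComplement M i y) () = _
    rw [hlits, hFl y, hev₁ y]
  have hsize : gs.length ≤ 24 * C.size + 6 + 22 * N ^ 3 := by
    have := oneSlice_size2_le (N := N) hN0
    omega
  -- step 4: constant elimination
  rcases const_or_exists_monotone_circuit gs (out ()) hR.wf hR.isOver (hR.outOK ()) with
    ⟨b, hb⟩ | ⟨C₂, hB₂, hs₂, hev₂⟩
  · -- `G` is the constant `b`: on the slice `C ≡ b`; use the AND / OR of all variables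
    have hCb : ∀ x : ι → Bool, (univ.filter fun i => x i = true).card = M → C.eval x = b := by
      intro x hx
      have h := hslice (fun j => x (e.symm j)) ((oneSlice_hammingWeight_comp e x).trans hx)
      rw [hb] at h
      simpa using h.symm
    have hne : (univ : Finset ι).toList ≠ [] := by
      rw [Ne, Finset.toList_eq_nil]
      exact (Finset.univ_nonempty_iff.2 (Fintype.card_pos_iff.1 hN0)).ne_empty
    have hlen : (univ : Finset ι).toList.length ≤ 24 * C.size + 6 + 22 * N ^ 3 := by
      rw [Finset.length_toList, card_univ]
      calc N ≤ N ^ 3 := by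
            calc N = N ^ 1 := (pow_one N).symm
              _ ≤ N ^ 3 := Nat.pow_le_pow_right hN0 (by norm_num)
        _ ≤ 24 * C.size + 6 + 22 * N ^ 3 := by omega
    cases b with
    | false =>
      obtain ⟨D, hDB, hDs, hDev⟩ := (cktSize_all (univ : Finset ι).toList hne).toCircuit
      refine ⟨D, hDB, hDs.trans hlen, fun x hx => ?_⟩
      rw [hDev x, hCb x hx]
      obtain ⟨i, hi⟩ := hoff x hx
      rw [Bool.eq_false_iff]
      intro hall
      rw [List.all_eq_true] at hall
      have := hall i (Finset.mem_toList.2 (mem_univ i))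
      rw [hi] at this
      exact Bool.false_ne_true this
    | true =>
      obtain ⟨D, hDB, hDs, hDev⟩ := (cktSize_any (univ : Finset ι).toList hne).toCircuit
      refine ⟨D, hDB, hDs.trans hlen, fun x hx => ?_⟩
      rw [hDev x, hCb x hx]
      obtain ⟨i, hi⟩ := hon x hx
      exact List.any_eq_true.2 ⟨i, Finset.mem_toList.2 (mem_univ i), hi⟩
  · -- `G` is computed over `{∧₂, ∨₂}` by `C₂` on `Fin N`: transport back to `ι`
    have h3 : CktSize monotoneBasis
        (fun (x : ι → Bool) (_ : Unit) => C₂.eval fun j => x (e.symm j)) C₂.size :=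
      (Circuit.cktSize_eval C₂ hB₂).rewire e.symm
    obtain ⟨C', hB', hs', hev'⟩ := h3.toCircuit
    refine ⟨C', hB', hs'.trans (hs₂.trans hsize), fun x hx => ?_⟩
    rw [hev' x]
    show C₂.eval (fun j => x (e.symm j)) = C.eval x
    rw [hev₂, hslice _ ((oneSlice_hammingWeight_comp e x).trans hx)]
    simp

/-- Final size bookkeeping: `24 s + 6 + 22 N³ ≤ 28 (s + n^28)` for `N ≤ n²`, `1 ≤ n`. [folklore] -/
theorem oneSlice_final_bound {s N n : ℕ} (hN : N ≤ n ^ 2) (hn : 1 ≤ n) :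
    24 * s + 6 + 22 * N ^ 3 ≤ 28 * (s + n ^ 28) := by
  have h1 : N ^ 3 ≤ n ^ 6 := by
    calc N ^ 3 ≤ (n ^ 2) ^ 3 := Nat.pow_le_pow_left hN 3
      _ = n ^ 6 := by ring
  have h2 : n ^ 6 ≤ n ^ 28 := Nat.pow_le_pow_right hn (by norm_num)
  have h3 : 1 ≤ n ^ 28 := Nat.one_le_pow _ _ hn
  omega

/-- **Item stmt-PneNP-2836** (`SliceMonotonization`, route OneSlice): Berkowitz's slice theorem
in crude polynomial form on the edge variables of `K_n` — with `c₀ = 28`, every `B₂`-circuit `C`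
has, for each `0 < M < C(n,2)`, a `{∧₂, ∨₂}`-circuit of size `≤ c₀ (|C| + n^{c₀})` agreeing with
`C` on all graphs with exactly `M` edges (Berkowitz 1982; Jukna 2012, Thm. 10.1; Valiant 1986;
Wegener 1985). [cite: Jukna2012, Thm. 10.1 (PDF p. 300)] -/
theorem sliceMonotonization_proof : Summit.PneNP.PneNP.Theses.OneSlice.SliceMonotonization := by
  unfold Summit.PneNP.PneNP.Theses.OneSlice.SliceMonotonization
  refine ⟨28, fun n M C hC hM0 hMN => ?_⟩
  classical
  have hcard := card_edgeSet_top_fin n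
  have hMN' : M < Fintype.card ((⊤ : SimpleGraph (Fin n)).edgeSet) := by
    rw [hcard]
    exact hMN
  obtain ⟨C', hB', hs', hev'⟩ := oneSlice_sliceMonotonization_core M hM0 hMN' C hC
  refine ⟨C', hB', hs'.trans ?_, fun x hx => hev' x ?_⟩
  · rw [hcard]
    have hn : 1 ≤ n := by
      rcases Nat.eq_zero_or_pos n with rfl | h
      · simp at hMN
      · exact h
    exact oneSlice_final_bound (Nat.choose_le_pow n 2) hn
  · convert hx

end Summit.PneNP.PneNP.Theorems
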